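import Literature.AnabelianGeometry.EtaleTheta.Discharge.Sec1ThetaCompanionOfAut
import Literature.AnabelianGeometry.AbsoluteAnabelian.AbsAnabFundamentalGroups

/-!
# `ι(Δ^tp_X) = Δ^tp_X` for an automorphism `ι` of `Π^tp_X`: the binder (R1b′)-hΔ as a NAMED input

S. Mochizuki, *Inter-universal Teichmüller theory II*, kurims (Dec. 2020), Rmk. 1.4.1 (ii) p. 28 (the pointed inversion
`ι`, «a `Δ`-outer automorphism» of `Π^tp_{X̲̲}` — an automorphism OVER `G_k`) [cite: Mochizuki2012, Rmk 1.4.1 (ii) p.28];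
S. Mochizuki, *The étale theta function …*, Publ. RIMS **45** (2009), proof of Thm. 1.6 p. 24 «the fact that `γ` maps
`Δ^tp_{Xα}` onto `Δ^tp_{Xβ}` [cf. [Mzk2], Lemma 1.3.8]»; S. Mochizuki, *The absolute anabelian geometry of canonical
curves* [AbsAnab], Lemma 1.3.8 p. 18 (the tree's FACT-LIST row F-0007 `FundamentalExtension.PreservesGeom`).

PROOF-ONLY companion (cell abc-iut, wave-4 seat abc-iut-w4-d014; NO definitions, NO `Prop`-valued facts; GAP row
G-w4d010-2, facet **(R1b′)-hΔ** of D-G-w4d010-2g and -2h, named for this seat by the (R1) custodian abc-iut-w5-d072 03:47:38Z).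
The binder `hΔ : D.DeltaTemp.map ι = D.DeltaTemp` of abc-iut-w5-d072's `thetaCompanionOfAut ι hΔ hq` (p416913) /
`prop22_ii'_model_of_inversion_of_hinv` (p420219) and abc-iut-w4-d014's `prop22_ii'_model_of_thetaKummer_of_aut` (p419591)
is DISCHARGED in the two printed situations:
* (a) the TRIVIAL case «`ι` over `G_K`» — `TemperedCurve.map_deltaTemp_eq_of_aug_conj` (`aug (ι x) = a·aug(x)·a⁻¹` for a
  fixed `a`, i.e. `ι` over `G_K` up to an inner automorphism of the Galois side) and `map_deltaTemp_eq_of_aug_comp`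
  (`aug ∘ ι = aug`): then `ι(Ker aug) = Ker aug` — pure algebra; this IS the reading of [IUTchII] Rmk. 1.4.1 (ii) (`ι`
  induced by an automorphism of the `k`-curve `X̲̲_k`);
* (b) the ANABELIAN case «any topological automorphism», BY NAME from [AbsAnab] Lem. 1.3.8 = F-0007:
  `ThetaSetting.map_deltaTemp_eq_of_map_deltaHat_completionAut` (tempered form from the profinite form
  `ι̂(Δ_X) = Δ_X`, `ι̂ =` d072's `completionAut ι`; `Δ^tp_X = Π^tp_X ∩ Δ_X`, root theorem `comap_toHat_deltaHat`) and
  `ThetaSetting.map_deltaHat_completionAut_of_preservesGeom` — the profinite form FROM the named fact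
  `FundamentalExtension.PreservesGeom` (F-0007) bound AT a [AbsTopIII]/[AbsAnab] fundamental extension `E` modelling
  `Π_X ↠ G_K` (binders: `E`, an identification `e : E.arith ≃ₜ* Π_X` with `e(Δ_E) = Δ_X`), and the composite
  `map_deltaTemp_eq_of_preservesGeom` («hΔ BY NAME from F-0007»).
Honest framing: (a) is unconditional algebra; (b) consumes F-0007 as a hypothesis at a named instance (the FACT policy); the
identification binders `(E, e, he)` say «Π_X with Δ_X IS an [AbsAnab] fundamental extension» and are data, not facts.
Nothing here bears on [IUTchIII] Cor. 3.12; typed ≠ proved.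
-/

noncomputable section

/-! ## (a) `ι` over `G_K` -/

namespace Literature.AnabelianGeometry.SemiGraphs

namespace TemperedCurve

variable {p : ℕ} [Fact p.Prime] (X : TemperedCurve p) (α : X.PiTemp ≃ₜ* X.PiTemp)

/-- **`α(Δ^tp_X) = Δ^tp_X` for `α` over `G_K` up to an inner automorphism of the Galois side**: if
`aug (α x) = a · aug(x) · a⁻¹` for a fixed `a` and all `x ∈ Π^tp_X`, then `α` maps `Δ^tp_X = Ker(aug)` onto itself
([IUTchII] Rmk. 1.4.1 (ii): the pointed inversion is an automorphism of `Π^tp_{X̲̲_k}` over `G_k`). PROVED (algebra).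
[cite: Mochizuki2012, Rmk 1.4.1 (ii) p.28] -/
theorem map_deltaTemp_eq_of_aug_conj (a : GQp p) (haug : ∀ x : X.PiTemp, X.aug (α x) = a * X.aug x * a⁻¹) :
    X.DeltaTemp.map α.toMulEquiv.toMonoidHom = X.DeltaTemp := by
  ext x
  simp only [TemperedCurve.DeltaTemp, Subgroup.mem_map, MonoidHom.mem_ker]
  constructor
  · rintro ⟨y, hy, rfl⟩
    change X.aug y = 1 at hy
    change X.aug (α y) = 1
    rw [haug, hy, mul_one, mul_inv_cancel]
  · intro hx
    change X.aug x = 1 at hx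
    refine ⟨α.symm x, ?_, ContinuousMulEquiv.apply_symm_apply α x⟩
    change X.aug (α.symm x) = 1
    have h := haug (α.symm x)
    rw [ContinuousMulEquiv.apply_symm_apply, hx] at h
    -- `1 = a * aug(α⁻¹ x) * a⁻¹`
    have : a⁻¹ * 1 * a = X.aug (α.symm x) := by rw [h]; group
    rw [← this]; group

/-- **`α(Δ^tp_X) = Δ^tp_X` for `α` over `G_K`** (`aug ∘ α = aug`). PROVED. [cite: Mochizuki2012, Rmk 1.4.1 (ii) p.28] -/
theorem map_deltaTemp_eq_of_aug_comp (haug : ∀ x : X.PiTemp, X.aug (α x) = X.aug x) :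
    X.DeltaTemp.map α.toMulEquiv.toMonoidHom = X.DeltaTemp :=
  X.map_deltaTemp_eq_of_aug_conj α 1 fun x => by rw [haug, one_mul, inv_one, mul_one]

end TemperedCurve

end Literature.AnabelianGeometry.SemiGraphs

/-! ## (b) the anabelian case: [AbsAnab] Lem. 1.3.8 BY NAME -/

namespace Literature.AnabelianGeometry.EtaleTheta

namespace ThetaSetting

open Literature.AnabelianGeometry.SemiGraphs Literature.AnabelianGeometry.AbsoluteAnabelian Topology

variable {p : ℕ} [Fact p.Prime] (D : ThetaSetting p) (ι : D.PiTemp ≃ₜ* D.PiTemp)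

/-- **Tempered form from the profinite form**: if `ι̂ := completionAut ι` maps `Δ_X` onto itself, then `ι` maps
`Δ^tp_X` onto itself — because `Δ^tp_X = Π^tp_X ∩ Δ_X` inside `Π_X` (root theorem `comap_toHat_deltaHat`, [EtTh] p. 12)
and `ι̂ ∘ ι_X = ι_X ∘ ι`. (abc-iut-L6-d5's `Thm16Sub.hΔ_of_map_deltaHat_eq` is the same statement for its own extension
`completionIso`; this is the `completionAut` form consumed by the (R1) chain.) [cite: MochizukiEtTh2009, Thm 1.6 (i) p.24] -/
theorem map_deltaTemp_eq_of_map_deltaHat_completionAut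
    (hΔhat : D.DeltaHat.map (D.toTemperedCurve.completionAut ι).toMulEquiv.toMonoidHom = D.DeltaHat) :
    D.DeltaTemp.map ι.toMulEquiv.toMonoidHom = D.DeltaTemp := by
  have hiff : ∀ x : D.PiTemp, x ∈ D.DeltaTemp ↔ ι x ∈ D.DeltaTemp := fun x => by
    rw [← D.comap_toHat_deltaHat]
    exact D.toTemperedCurve.mem_comap_toHat_iff_of_map_completionAut ι D.DeltaHat hΔhat x
  ext x
  constructor
  · rintro ⟨y, hy, rfl⟩
    exact (hiff y).mp hy
  · intro hx
    refine ⟨ι.symm x, (hiff _).mpr ?_, ContinuousMulEquiv.apply_symm_apply ι x⟩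
    rwa [ContinuousMulEquiv.apply_symm_apply]

/-- **The profinite form FROM [AbsAnab] Lem. 1.3.8 BY NAME (FACT-LIST F-0007 `FundamentalExtension.PreservesGeom`).**
Bind the fact AT a fundamental extension `E` ([AbsTopIII]/[AbsAnab] `1 → Δ → Π → G → 1`, abc-iut-L4-t1) modelling
`Π_X ↠ G_K`: given an identification `e : Π_E ⥲ Π_X` of topological groups carrying `Δ_E` onto `Δ_X`, the instance
`PreservesGeom (e ≫ ι̂ ≫ e⁻¹)` of Lem. 1.3.8 («`Δ ⊆ Π` is group-theoretic»; print p. 24 «[cf. [Mzk2], Lemma 1.3.8]») gives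
`ι̂(Δ_X) = Δ_X`. [cite: MochizukiAbsAnab2004, Lemma 1.3.8 p.18] -/
theorem map_deltaHat_completionAut_of_preservesGeom (E : FundamentalExtension.{0}) (e : E.arith ≃ₜ* D.PiHat)
    (he : E.geom.map e.toMulEquiv.toMonoidHom = D.DeltaHat)
    (h138 : FundamentalExtension.PreservesGeom (F := E)
      (e.trans ((D.toTemperedCurve.completionAut ι).trans e.symm))) :
    D.DeltaHat.map (D.toTemperedCurve.completionAut ι).toMulEquiv.toMonoidHom = D.DeltaHat := by
  have h := congrArg (Subgroup.map e.toMulEquiv.toMonoidHom) h138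
  rw [he, Subgroup.map_map] at h
  have hcomp : e.toMulEquiv.toMonoidHom.comp
      (e.trans ((D.toTemperedCurve.completionAut ι).trans e.symm)).toMulEquiv.toMonoidHom =
        (D.toTemperedCurve.completionAut ι).toMulEquiv.toMonoidHom.comp e.toMulEquiv.toMonoidHom := by
    ext x
    change e (e.symm (D.toTemperedCurve.completionAut ι (e x))) = D.toTemperedCurve.completionAut ι (e x)
    rw [ContinuousMulEquiv.apply_symm_apply]
  rw [hcomp, ← Subgroup.map_map, he] at h
  exact h

/-- **(R1b′)-hΔ BY NAME from F-0007**: `ι(Δ^tp_X) = Δ^tp_X` for ANY topological automorphism `ι` of `Π^tp_X`, given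
[AbsAnab] Lem. 1.3.8 at the fundamental extension `(E, e)` modelling `Π_X ↠ G_K` ([EtTh] proof of Thm. 1.6 p. 24 «the fact
that `γ` maps `Δ^tp_{Xα}` onto `Δ^tp_{Xβ}` [cf. [Mzk2], Lemma 1.3.8]»). [cite: MochizukiEtTh2009, Thm 1.6 (i) p.24] -/
theorem map_deltaTemp_eq_of_preservesGeom (E : FundamentalExtension.{0}) (e : E.arith ≃ₜ* D.PiHat)
    (he : E.geom.map e.toMulEquiv.toMonoidHom = D.DeltaHat)
    (h138 : FundamentalExtension.PreservesGeom (F := E)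
      (e.trans ((D.toTemperedCurve.completionAut ι).trans e.symm))) :
    D.DeltaTemp.map ι.toMulEquiv.toMonoidHom = D.DeltaTemp :=
  D.map_deltaTemp_eq_of_map_deltaHat_completionAut ι (D.map_deltaHat_completionAut_of_preservesGeom ι E e he h138)

/-- (a) at the theta setting, for the consumers' `D : ThetaSetting p`: `ι` over `G_K` up to `Inn` ⇒ `ι(Δ^tp_X) = Δ^tp_X`.
[cite: Mochizuki2012, Rmk 1.4.1 (ii) p.28] -/
theorem map_deltaTemp_eq_of_aug_conj (a : GQp p) (haug : ∀ x : D.PiTemp, D.aug (ι x) = a * D.aug x * a⁻¹) :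
    D.DeltaTemp.map ι.toMulEquiv.toMonoidHom = D.DeltaTemp :=
  D.toTemperedCurve.map_deltaTemp_eq_of_aug_conj ι a haug

end ThetaSetting

end Literature.AnabelianGeometry.EtaleTheta

end
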